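import Literature.NumberTheory.EllipticCurves.BinaryQuarticForms
import HarnessLib

/-!
# The invariant map `f ↦ (I(f), J(f))` is submersive off the discriminant locus:
# `648·Δ` lies in the ideal of the `2 × 2` minors of the Jacobian of `(I, J)`

`Proofs` companion (theorems only: no definitions, no named facts) of `BinaryQuarticForms.lean`.

Source and role. M. Bhargava, A. Shankar, *Binary quartic forms having bounded invariants, and the
boundedness of the average rank of elliptic curves*, Ann. of Math. (2) 181 (2015) 191–242. The
`p`-adic change-of-measure formula behind the local masses of Prop. 5.12 of the held arXiv text
`arXiv:1006.1002v2` (Props. 3.7–3.9 of the published version: for a set `S ⊂ V_{ℤ_p}` defined by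
conditions on `(I, J)`, `μ_p(S) = |1/27|_p · Vol(PGL₂(ℤ_p)) · Σ 1/#Stab · ∫ dI dJ`), like the real
Jacobian identity of Prop. 2.7, uses that `V → 𝔸²`, `f ↦ (I(f), J(f))` is smooth (submersive) at
every form with `Δ(f) ≠ 0`; over `ℤ_p` this is what makes the fibres `{(I, J) ≡ (I₀, J₀) (mod p^k)}`
Hensel-liftable with exactly `p³` lifts at each step (so that, with `#{(I,J) = (I₀,J₀)} = p³ − p`
over `𝔽_p`, `BinaryQuarticInvariantCountProofs`, the fibre over a residue class modulo `p^k` has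
`(1 − p⁻²)p^{3k}` elements). This file proves the underlying polynomial identity, over any
commutative ring: with `∂I = (12e, −3d, 2c, −3b, 12a)` and
`∂J = (72ce − 27d², 9cd − 54be, 72ae + 9bd − 6c², 9bc − 54ad, 72ac − 27b²)`, and the minors
`m_{ab} = ∂_aI ∂_bJ − ∂_bI ∂_aJ` etc.,

  `648 · Δ(f) = m_{ab}·(27b³ − 128abc + 216a²d) + m_{ac}·(12b²c − 48ac² − 6abd + 192a²e)
              + m_{ad}·(5b²d − 20acd)`

(`BinaryQuartic.disc_mem_jacobianMinors`). Consequently, over a field in which `2 ≠ 0`, `3 ≠ 0`,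
**at a form with `Δ(f) ≠ 0` the gradients `∂I(f)`, `∂J(f)` are linearly independent**
(`BinaryQuartic.jacobianMinor_ne_zero_of_disc_ne_zero`: one of `m_{ab}, m_{ac}, m_{ad}` is nonzero).

## References

* M. Bhargava, A. Shankar, Ann. of Math. (2) 181 (2015) 191–242 = arXiv:1006.1002, Prop. 2.7 and
  Prop. 5.12 of the arXiv v2 text (Props. 2.8, 3.7–3.9 of the published version).
  [cite: BhargavaShankarAnnals2015, Prop. 5.12 (arXiv:1006.1002v2 numbering)]
* The identity is classical invariant theory (the quotient map of binary quartics by `SL₂` is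
  smooth on the stable locus). [folklore]
-/

namespace Literature.NumberTheory.EllipticCurves

namespace BinaryQuartic

variable {R : Type*} [CommRing R]

/-- **`648·Δ` in the ideal of the Jacobian minors of `(I, J)`**, with explicit integral cofactors;
`m_{ab} = ∂_aI·∂_bJ − ∂_bI·∂_aJ`, `m_{ac}`, `m_{ad}` written out. [folklore] -/
theorem disc_mem_jacobianMinors (f : BinaryQuartic R) :
    648 * f.disc =
      ((12 * f.e) * (9 * f.c * f.d - 54 * f.b * f.e) - (-3 * f.d) * (-27 * f.d ^ 2 + 72 * f.c * f.e))
          * (27 * f.b ^ 3 - 128 * f.a * f.b * f.c + 216 * f.a ^ 2 * f.d)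
      + ((12 * f.e) * (-6 * f.c ^ 2 + 9 * f.b * f.d + 72 * f.a * f.e)
            - (2 * f.c) * (-27 * f.d ^ 2 + 72 * f.c * f.e))
          * (12 * f.b ^ 2 * f.c - 48 * f.a * f.c ^ 2 - 6 * f.a * f.b * f.d + 192 * f.a ^ 2 * f.e)
      + ((12 * f.e) * (9 * f.b * f.c - 54 * f.a * f.d) - (-3 * f.b) * (-27 * f.d ^ 2 + 72 * f.c * f.e))
          * (5 * f.b ^ 2 * f.d - 20 * f.a * f.c * f.d) := by
  simp only [disc]; ring

/-- The partial derivatives used above are those of `I = 12ae − 3bd + c²` and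
`J = 72ace + 9bcd − 27ad² − 27eb² − 2c³`: the exact first-order expansions in the `a`-direction,
`I(f + t·x⁴) = I(f) + t·12e`, `J(f + t·x⁴) = J(f) + t·(72ce − 27d²)`. [folklore] -/
theorem I_J_add_a (f : BinaryQuartic R) (t : R) :
    (⟨f.a + t, f.b, f.c, f.d, f.e⟩ : BinaryQuartic R).I = f.I + t * (12 * f.e) ∧
      (⟨f.a + t, f.b, f.c, f.d, f.e⟩ : BinaryQuartic R).J = f.J + t * (-27 * f.d ^ 2 + 72 * f.c * f.e) := by
  constructor
  · simp only [I]; ring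
  · simp only [J]; ring

/-- First-order expansions in the `b`-direction: `∂_bI = −3d`, `∂_bJ = 9cd − 54be`. [folklore] -/
theorem I_J_add_b (f : BinaryQuartic R) (t : R) :
    (⟨f.a, f.b + t, f.c, f.d, f.e⟩ : BinaryQuartic R).I = f.I + t * (-3 * f.d) ∧
      (⟨f.a, f.b + t, f.c, f.d, f.e⟩ : BinaryQuartic R).J =
        f.J + t * (9 * f.c * f.d - 54 * f.b * f.e) + t ^ 2 * (-27 * f.e) := by
  constructor
  · simp only [I]; ring
  · simp only [J]; ring

/-- First-order expansions in the `c`-direction: `∂_cI = 2c`, `∂_cJ = 72ae + 9bd − 6c²`. [folklore] -/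
theorem I_J_add_c (f : BinaryQuartic R) (t : R) :
    (⟨f.a, f.b, f.c + t, f.d, f.e⟩ : BinaryQuartic R).I = f.I + t * (2 * f.c) + t ^ 2 ∧
      (⟨f.a, f.b, f.c + t, f.d, f.e⟩ : BinaryQuartic R).J =
        f.J + t * (-6 * f.c ^ 2 + 9 * f.b * f.d + 72 * f.a * f.e) + t ^ 2 * (-6 * f.c) + t ^ 3 * (-2) := by
  constructor
  · simp only [I]; ring
  · simp only [J]; ring

/-- First-order expansions in the `d`-direction: `∂_dI = −3b`, `∂_dJ = 9bc − 54ad`. [folklore] -/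
theorem I_J_add_d (f : BinaryQuartic R) (t : R) :
    (⟨f.a, f.b, f.c, f.d + t, f.e⟩ : BinaryQuartic R).I = f.I + t * (-3 * f.b) ∧
      (⟨f.a, f.b, f.c, f.d + t, f.e⟩ : BinaryQuartic R).J =
        f.J + t * (9 * f.b * f.c - 54 * f.a * f.d) + t ^ 2 * (-27 * f.a) := by
  constructor
  · simp only [I]; ring
  · simp only [J]; ring

/-- **Submersivity of `(I, J)` off `Δ = 0`**: over a field with `2 ≠ 0`, `3 ≠ 0`, at a form with
`Δ(f) ≠ 0` one of the Jacobian minors `m_{ab}`, `m_{ac}`, `m_{ad}` is nonzero, i.e. `∂I(f)` and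
`∂J(f)` are linearly independent. [folklore] -/
theorem jacobianMinor_ne_zero_of_disc_ne_zero {K : Type*} [Field K] (h2 : (2 : K) ≠ 0)
    (h3 : (3 : K) ≠ 0) {f : BinaryQuartic K} (hΔ : f.disc ≠ 0) :
    (12 * f.e) * (9 * f.c * f.d - 54 * f.b * f.e) - (-3 * f.d) * (-27 * f.d ^ 2 + 72 * f.c * f.e) ≠ 0 ∨
    (12 * f.e) * (-6 * f.c ^ 2 + 9 * f.b * f.d + 72 * f.a * f.e)
        - (2 * f.c) * (-27 * f.d ^ 2 + 72 * f.c * f.e) ≠ 0 ∨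
    (12 * f.e) * (9 * f.b * f.c - 54 * f.a * f.d) - (-3 * f.b) * (-27 * f.d ^ 2 + 72 * f.c * f.e) ≠ 0 := by
  by_contra h
  simp only [not_or, not_not] at h
  obtain ⟨h₁, h₂, h₃⟩ := h
  have h648 : (648 : K) ≠ 0 := by
    rw [show (648 : K) = 2 * 2 * 2 * 3 * 3 * 3 * 3 by norm_num]
    exact mul_ne_zero (mul_ne_zero (mul_ne_zero (mul_ne_zero (mul_ne_zero (mul_ne_zero h2 h2) h2)
      h3) h3) h3) h3
  apply mul_ne_zero h648 hΔ
  rw [disc_mem_jacobianMinors, h₁, h₂, h₃]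
  ring

end BinaryQuartic

end Literature.NumberTheory.EllipticCurves
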